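import Literature.MathematicalPhysics.QuantumFieldTheory.Balaban1983to89.B9LettersZCFieldsAtPins
import Literature.MathematicalPhysics.QuantumFieldTheory.Balaban1983to89.B9BackgroundsKLevelV1R
import Literature.MathematicalPhysics.QuantumFieldTheory.Balaban1983to89.Node00.OpsYRecordV4P

/-!
# BalabanUVNodes ∕ N06 ([B9], `Dag.B9_main`) — THE DISPLAYED BLOCK-L² LETTER `hLL2`.1.c1 (C₁ = (QG₁Q\*)⁻¹ in block L², weights (√n⁻¹·Lʲη)⁻¹ ⊗ (…)⁻¹) OF THE
# STAGE-11 CERTIFICATE DERIVED AT THE PINS from the (3.132) class letter of C₁ the certificate ALREADY derives (`zletters_of_pins`, conjunct 5) — dag-n06-w5 g4's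
# `B9LettersZCFieldsAtPins.c1_l2_pins` (there at `bg9Y`) re-pressed over the class-parametric background `bg9YR R₁ R₂` (Schur + the counting self-transpose of `C1coK`)

Track A of `YM-PLAN.md` (cell `pub-ymgap`, HUMAN RULING D-0062), node **N06** = [Balaban1985BackgroundPropagators] Thms 3.1–3.15; rows 20–21, seat
`pub-ymgap-dag-n06-c` (g21; LOCATED-25).  A HELPER for dag-n06-d's certificate editions after ED.93 «UT».
WHY.  The certificate displays `hLL2 : … Letters313L2Pk (𝔬12 x) … B13₄ δ12₃ vZ … U ∧ …` whose field `c1` is ‖1_{Δ(y)}C₁μ‖₂ ≦ B13₄·(vZ(y)·Lʲη)⁻¹·(vZ(y′)·L^{j′}η)⁻¹·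
e^{−δ12₃d(y,y′)}‖μ‖₂ (`vZ y = √(n(y)⁻¹)`, `n(y) = (L^{d+1})^{lvl y}`), although it DERIVES (ED.81, `…N06ZLettersLegAtPinsPU.zletters_of_pins` conjunct 5, from row 26's
(3.132) `s3132`) the sup-class letter `HasMaj 𝔠_Z⁽²⁾ Z_{n⁻¹} (C₁(U)) (Bz·e^{−δCd})` and displays the symmetry `hΔ2 : IsSymmTr 1 ((𝔯 x).Δ2 U)` of the residual datum and
the pin `hC1co12` (C₁ = node00-def-Y's `C1coK … (𝔯 x).Δ2`).  dag-n06-w5 g4 typed the passage (p. 398 transfer-free, p. 391 adjoints): the block-L² field follows from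
the sup field and `IsTransposePair C₁ C₁` by SCHUR (`B9RWSums346Schur.blockBd_schur`, packaged as the GENERIC `B9LettersZCFieldsAtPins.c1_l2_of_c1_2`), and
`C1coK` is its own counting-transpose at a `U(N)`-valued configuration with trace-symmetric `G₁(U)` (GENERIC `isTransposePair_C1coK`; `G₁` symmetric from `hΔ2` by
node00-def-Y's `G1Y_GpPhysY_isSymmTr_parSymY`) — but the member package `c1_l2_pins` fixed the record to `bg9Y` (pre-R-generic), so the knit never folded it.
THIS FILE re-presses it over `bg9YR R₁ R₂` in the certificate's binder shapes, pointwise in the member and the configuration (no threshold, no new numeric):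
★★ `c1L2_of_pinsR` — from `hGR` («`U` SU(N)-valued»), `hC1co12`, `hΔ2` and the DERIVED sup letter at `(B, δ)`: the `c1` field at the SAME `(B, δ)`.
The knit (dag-n06-d's pen): `c1 := c1L2_of_pinsR hGR 𝔬12 (fun x => (𝔯 x).Δ2) hC1co12 hΔ2 x U hU hB (hZL x …).2.2.2.2.1` at `(Bz, δC)`, mono'd to `(B13₄, δ12₃)` as the
other `hLL2` fields (`δ12₃ ≤ δC` by `scaled_rates`).  AFTER this, LOCATED-23 (`gDv dGDv dGDvd`), LOCATED-24 (`rgdI`) and dag-n06-l's P-DISP 6 (`gQs ddGQs dGQs q dGQsd`),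
`hLL2` displays only the SECOND-ORDER G′ members `rgdDs` (L2Pk) and `rgdDd` (L2MZ) — RD\*G₁∇\*_U = RG′D\*∇\*_U by (3.152), a `G′D\*∇\*` block-L² line from rows 18's
`L2SecondLegs37` (n06-k `B9RWSums346SecondDiffGp.l2line5_of_local37`, unconsumed).
HONEST FRAMING.  By-name composition of kernel-checked helper files; the (3.132) letter is a HYPOTHESIS here (derived in the certificate from row 26); nothing of
[B9]'s (3.132) ∕ Theorems 3.12–3.13 asserted; COUNT-NEUTRAL; N06 NOT discharged; K1 NOT closed; one finite 𝕋⁴ programme at fixed `ε` — NOT continuum, NOT OS, NOT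
the mass gap ∕ Clay.  0 `def`, 0 `sorry`.
-/

noncomputable section

namespace Summit.QuantumFields.YangMills.BalabanUVNodes.N06C1L2LegAtPinsR

open scoped Matrix.Norms.L2Operator
open Literature.MathematicalPhysics.QuantumFieldTheory.Balaban1983to89
open Literature.MathematicalPhysics.QuantumFieldTheory.Balaban1983to89.Node00
open Literature.MathematicalPhysics.QuantumFieldTheory.Balaban1983to89.B9PinMembersKLevelV1 (MemberY geo9Y)
open Literature.MathematicalPhysics.QuantumFieldTheory.Balaban1983to89.B9BackgroundsKLevelV1R (RegFamY bg9YR MemOfFam mem_of_reg335R)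
open Literature.MathematicalPhysics.QuantumFieldTheory.Balaban1983to89.B7Prop2SpecialUnitary (specialUnitaryUnits specialUnitaryUnits_le_unitaryUnits)
open Literature.MathematicalPhysics.QuantumFieldTheory.Balaban1983to89.B6Ineq2142KLevelV1 (lvl)
open Literature.MathematicalPhysics.QuantumFieldTheory.Balaban1983to89.B9CoReadingCoordsTranspose (TrIdx trBasis)
open Literature.MathematicalPhysics.QuantumFieldTheory.Balaban1983to89.B9CoReadingCoords (XBK)
open Literature.MathematicalPhysics.QuantumFieldTheory.Balaban1983to89.B9CoReadingCoordsH (XHK)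
open Literature.MathematicalPhysics.QuantumFieldTheory.Balaban1983to89.B9GeoNormsKLevelV1 (geo9K geo9K_dist_nonneg)
open Literature.MathematicalPhysics.QuantumFieldTheory.Balaban1983to89.B9GeoLemma21KLevelV1 (geo9Y_dist_triangle geo9Y_dist_comm geo9Y_len_pos)
open Literature.MathematicalPhysics.QuantumFieldTheory.Balaban1983to89.B9Thm34Ext (toB6)
open Literature.MathematicalPhysics.QuantumFieldTheory.Balaban1983to89.B9SectDSup (weightNorm)
open Literature.MathematicalPhysics.QuantumFieldTheory.Balaban1983to89.B9SectDL2Decay (BlockBd)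
open Literature.MathematicalPhysics.QuantumFieldTheory.Balaban1983to89.B11SectG (HasMaj BlockNorm)
open Literature.MathematicalPhysics.QuantumFieldTheory.Balaban1983to89.B9Thm312Whole (Ops GeoOK cNorm)
open Literature.MathematicalPhysics.QuantumFieldTheory.Balaban1983to89.B9Thm37Glue (IsTransposePair)
open Literature.MathematicalPhysics.QuantumFieldTheory.Balaban1983to89.B9Thm311ReadingCoords (IsSymmTr)
open Literature.MathematicalPhysics.QuantumFieldTheory.Balaban1983to89.Node00.OpsYSectDCoords (C1coK)
open Literature.MathematicalPhysics.QuantumFieldTheory.Balaban1983to89.B9LettersZCFieldsAtPins (c1_l2_of_c1_2 isTransposePair_C1coK)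

variable {N : ℕ}

/-- ★★ **`hLL2`.1.c1 AT THE PINS, EVERY MEMBER, EVERY REGULAR `U`** (module docstring): at a record `𝔬12 x` whose letter `C1` is pinned to node00-def-Y's
`C1coK … (parSymY) (parBY) (GpPhysY (parSymY)) (Δ2 x)` (`hC1co12`), for an SU(N)-valued configuration (read off `hGR` and `Reg335`) with a trace-symmetric residual
datum (`hΔ2`), the DERIVED (3.132) class letter `HasMaj 𝔠_Z⁽²⁾ Z_{n⁻¹} (C₁(U)) (B·e^{−δd})` (`zletters_of_pins`, conjunct 5) gives the block-L² field
‖1_{Δ(y)}C₁μ‖₂ ≦ B·(√(n(y)⁻¹)·Lʲη)⁻¹·(√(n(y′)⁻¹)·L^{j′}η)⁻¹·e^{−δd(y,y′)}‖μ‖₂ — `Letters313L2Pk.c1`'s statement at the SAME `(B, δ)`, any block map `blkZ`.  Inside: dag-n06-w5's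
`c1_l2_of_c1_2` (Schur) and `isTransposePair_C1coK`, def-Y's `G1Y_GpPhysY_isSymmTr_parSymY`.
[cite: Balaban1985BackgroundPropagators, (3.132) p.422, Thm 3.13 p.426 + (3.46) p.398 + p.391 (the L² adjoints), (3.128)–(3.129) p.421, Thm 3.11 p.416; Balaban1984PropagatorsII, (2.51) p.232] -/
theorem c1L2_of_pinsR {θ : Stage3Params} {Mstar : ℕ} {R₁ R₂ : RegFamY θ.d₆ θ.ℓ₆ θ.hd' θ.hL' θ.b₀ θ.b₁ Mstar (Matrix (Fin N) (Fin N) ℂ)} {c : ℝ}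
    (hGR : MemOfFam (specialUnitaryUnits (Fin N)) R₁)
    [∀ x : MemberY θ.d₆ θ.ℓ₆ θ.hd' θ.hL' θ.b₀ θ.b₁ Mstar, Fintype (geo9Y x).Site]
    {H12 : MemberY θ.d₆ θ.ℓ₆ θ.hd' θ.hL' θ.b₀ θ.b₁ Mstar → Prop}
    {X12 Y12 W12 : MemberY θ.d₆ θ.ℓ₆ θ.hd' θ.hL' θ.b₀ θ.b₁ Mstar → Type} [∀ x, Fintype (X12 x)] [∀ x, Fintype (Y12 x)] [∀ x, Fintype (W12 x)]
    (𝔬12 : ∀ x : MemberY θ.d₆ θ.ℓ₆ θ.hd' θ.hL' θ.b₀ θ.b₁ Mstar, B9Thm312Whole.Ops (geo9Y x) (bg9YR (Matrix (Fin N) (Fin N) ℂ) (specialUnitaryUnits (Fin N)) R₁ R₂ x) (X12 x) (Y12 x) (XHK (TrIdx N) x.toKIdx) (W12 x))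
    (Δ2 : ∀ x : MemberY θ.d₆ θ.ℓ₆ θ.hd' θ.hL' θ.b₀ θ.b₁ Mstar, BondOpY (Matrix (Fin N) (Fin N) ℂ) x.toKIdx)
    (hC1co12 : ∀ (x : MemberY θ.d₆ θ.ℓ₆ θ.hd' θ.hL' θ.b₀ θ.b₁ Mstar) (U : (bg9YR (Matrix (Fin N) (Fin N) ℂ) (specialUnitaryUnits (Fin N)) R₁ R₂ x).Cfg),
      (𝔬12 x).C1 U = C1coK x.toKIdx (trBasis N) (bg9YR (Matrix (Fin N) (Fin N) ℂ) (specialUnitaryUnits (Fin N)) R₁ R₂ x) (fun U => U)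
        (parSymY x.toKIdx) (parBY x.toKIdx) (GpPhysY x.toKIdx (parSymY x.toKIdx)) (Δ2 x) U)
    (hΔ2 : ∀ (x : MemberY θ.d₆ θ.ℓ₆ θ.hd' θ.hL' θ.b₀ θ.b₁ Mstar) (U : (bg9YR (Matrix (Fin N) (Fin N) ℂ) (specialUnitaryUnits (Fin N)) R₁ R₂ x).Cfg),
      (∀ μ z, U μ z ∈ specialUnitaryUnits (Fin N)) → IsSymmTr (fun _ => (1 : ℝ)) (Δ2 x U))
    (x : MemberY θ.d₆ θ.ℓ₆ θ.hd' θ.hL' θ.b₀ θ.b₁ Mstar) {α₀ : ℝ} (U : (bg9YR (Matrix (Fin N) (Fin N) ℂ) (specialUnitaryUnits (Fin N)) R₁ R₂ x).Cfg)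
    (hU : (bg9YR (Matrix (Fin N) (Fin N) ℂ) (specialUnitaryUnits (Fin N)) R₁ R₂ x).Reg335 c α₀ U)
    {B δ : ℝ} (hB : 0 ≤ B)
    (hpl : ∀ y : (geo9Y x).Site, 0 ≤ ((((θ.ℓ₆ + 1 : ℕ) : ℝ) ^ (θ.d₆ + 1)) ^ lvl x.hN x.D x.hk y)⁻¹)
    (hc12 : HasMaj (cNorm 1 (H12 x) (𝔬12 x).blkZ (fun y => (geo9Y_len_pos x y).le) 2)
      (weightNorm (BlockNorm.ofBlocks (toB6 (geo9Y x) 1 (H12 x)) (𝔬12 x).blkZ) (fun y => ((((θ.ℓ₆ + 1 : ℕ) : ℝ) ^ (θ.d₆ + 1)) ^ lvl x.hN x.D x.hk y)⁻¹) hpl)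
      ((𝔬12 x).C1 U) (fun a b => B * Real.exp (-(δ * (geo9Y x).dist a b)))) :
    BlockBd (g := toB6 (geo9Y x) 1 (H12 x)) (𝔬12 x).blkZ (𝔬12 x).blkZ ((𝔬12 x).C1 U)
      (fun (y y' : (geo9Y x).Site) => B * (Real.sqrt ((((θ.ℓ₆ + 1 : ℕ) : ℝ) ^ (θ.d₆ + 1)) ^ lvl x.hN x.D x.hk y)⁻¹ * (geo9Y x).len y)⁻¹ *
        (Real.sqrt ((((θ.ℓ₆ + 1 : ℕ) : ℝ) ^ (θ.d₆ + 1)) ^ lvl x.hN x.D x.hk y')⁻¹ * (geo9Y x).len y')⁻¹ * Real.exp (-(δ * (geo9Y x).dist y y'))) := by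
  letI : Fintype (geo9K x.toKIdx).Site := (inferInstance : Fintype (geo9Y x).Site)
  have hG : GeoOK (geo9Y x) := ⟨geo9Y_dist_triangle x, geo9Y_dist_comm x, geo9K_dist_nonneg x.toKIdx, geo9Y_len_pos x⟩
  have hUG : ∀ μ z, U μ z ∈ specialUnitaryUnits (Fin N) := fun μ z => mem_of_reg335R hGR x hU μ z
  have hplp : ∀ y : (geo9Y x).Site, 0 < ((((θ.ℓ₆ + 1 : ℕ) : ℝ) ^ (θ.d₆ + 1)) ^ lvl x.hN x.D x.hk y)⁻¹ := fun y => by positivity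
  -- G₁(U) is trace-symmetric at the symmetrised tables for a symmetric residual datum (node00-def-Y)
  have hG1 : IsSymmTr (fun _ => (1 : ℝ)) (G1Y x.toKIdx (parSymY x.toKIdx) (parBY x.toKIdx) (GpPhysY x.toKIdx (parSymY x.toKIdx)) (Δ2 x) U) :=
    G1Y_GpPhysY_isSymmTr_parSymY x.toKIdx (specialUnitaryUnits_le_unitaryUnits (n := Fin N)) hUG (Δ2 x) (hΔ2 x U hUG)
  -- C₁'s model is its own counting-transpose (dag-n06-w5)
  have hT' := isTransposePair_C1coK x.toKIdx (bg9YR (Matrix (Fin N) (Fin N) ℂ) (specialUnitaryUnits (Fin N)) R₁ R₂ x) (fun U => U)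
    (parSymY x.toKIdx) (GpPhysY x.toKIdx (parSymY x.toKIdx)) (Δ2 x) (specialUnitaryUnits_le_unitaryUnits (n := Fin N)) U hUG hG1
  have hT : IsTransposePair ((𝔬12 x).C1 U) ((𝔬12 x).C1 U) := by rw [hC1co12 x U]; exact hT'
  -- Schur (dag-n06-w5's `c1_l2_of_c1_2`)
  exact c1_l2_of_c1_2 (R₀ := (1 : ℝ)) (H₀ := H12 x) hG hB hplp hc12 hT

end Summit.QuantumFields.YangMills.BalabanUVNodes.N06C1L2LegAtPinsR

end
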